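import Literature.Computability.Complexity.CircuitInputMap
import Literature.Computability.MetaComplexity.MCSPProofs

/-! # SoloInformedPadding — variable padding inside `MCSP[s]`: the slices of the streaming door

Solo informed, generation 6.  Circuit complexity over any basis is invariant under renaming the
variables along a map with a left inverse (in particular under adding dummy variables), because
`Circuit.mapInputs` transports circuits both ways with the same gates.  Consequently the truth
table of an `m`-variable function `g`, padded with `d` dummy variables, lies in `MCSP[s]` at
length `2^(d+m)` iff `circuitSizeOver B2 g ≤ s (d + m)`; with the dummies as the LOW-order
variables the padded table is the table of `g` with every bit repeated `2^d` times
(`…[p] = (tt g)[p / 2^d]`), with the dummies HIGH-order it is `tt g` repeated `2^d` times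
(`…[p] = (tt g)[p % 2^m]`).

Why this matters for the summit (`StreamingLowerBound (fun n => n) → PneNP`, generations 4–5):
the language `MCSP[n]` at length `N = 2ⁿ` is not the "nearly read-once" recognition problem — for
every `1 ≤ m ≤ n` it contains, blockwise, the problem "does the `m`-variable function `g` have a
`B2`-circuit with at most `n` gates", in particular the slices `n = λ·m` (linear-size circuits),
`n = m^k` (polynomial-size circuits) and `n = 2^{m/2}`.  A one-pass decider for `MCSP[n]` with
`(log₂ N)^c + c` state bits and update steps, fed each bit of `tt g` `2^{n-m}` times, decides the
slice `(m, n)` one-pass in space `poly(n)` and total time `2ⁿ·poly(n)` — for `n = m^k` that is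
`2^{(log₂ N')^k}·polylog` on tables of length `N' = 2^m`, where no algorithm of running time
`2^{o(m^k log m)}` is known (uniform exhaustive search over the `2^{Θ(m^k log m)}` circuits;
non-uniformly, circuits of size `2^{(4/5)w + o(w)}·poly(N')`, `w = m^k·log₂(m^k + m)`,
Hirahara–Ilango–Williams, STOC 2024, Thm 1.3).  (The simulation itself is a remark in the seat's
report; this file proves the language-level facts it rests on.)
-/

namespace Summit.PneNP.PneNP.Theorems
open Literature.Computability.Complexity Literature.Computability.MetaComplexity
open Literature.Computability.MetaComplexity.MCSPVerif (getElem_truthTable lowBits_apply)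

/-- **Circuit complexity is invariant under variable renaming with a left inverse.**  For any
basis `B`, any `e : ι → κ` with left inverse `r` (`r (e i) = i`) and any `g : (ι → Bool) → Bool`,
the function `u ↦ g (u ∘ e)` on the variables `κ` has the same circuit complexity over `B` as
`g`: a circuit for `g` renamed along `e` computes it, and a circuit for it renamed along `r`
computes `g` back (the padded function ignores the variables outside the range of `e`, so they
may be fed copies of genuine variables).  Both sides are the junk value `0` together. -/
theorem soloInformed_circuitSizeOver_comp_eq {ι κ : Type*} (B : Set GateFn) (e : ι → κ)
    (r : κ → ι) (hre : ∀ i, r (e i) = i) (g : (ι → Bool) → Bool) :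
    circuitSizeOver B (fun u : κ → Bool => g (fun i => u (e i))) = circuitSizeOver B g := by
  unfold circuitSizeOver
  congr 1
  ext s
  constructor
  · rintro ⟨D, hB, hD, rfl⟩
    refine ⟨D.mapInputs r, hB.mapInputs r, fun x => ?_, by simp⟩
    rw [Circuit.eval_mapInputs, hD]
    simp only [hre]
  · rintro ⟨C, hB, hC, rfl⟩
    refine ⟨C.mapInputs e, hB.mapInputs e, fun u => ?_, by simp⟩
    rw [Circuit.eval_mapInputs, hC]

/-- **Dummy variables are free (low-order dummies).**  Padding an `m`-variable function with `d`
dummy variables placed BELOW its variables (`g` reads the coordinates `d, …, d+m-1`) does not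
change its circuit complexity over any basis, provided `m ≥ 1`. -/
theorem soloInformed_circuitSizeOver_padLow_eq (B : Set GateFn) {m : ℕ} (hm : 0 < m) (d : ℕ)
    (g : (Fin m → Bool) → Bool) :
    circuitSizeOver B (fun u : Fin (d + m) → Bool => g (fun i => u (Fin.natAdd d i))) =
      circuitSizeOver B g := by
  refine soloInformed_circuitSizeOver_comp_eq B (Fin.natAdd d)
    (fun k => if h : d ≤ (k : ℕ) then ⟨k - d, by omega⟩ else ⟨0, hm⟩) (fun i => ?_) g
  simp

/-- **Dummy variables are free (high-order dummies).**  Padding an `m`-variable function with `d`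
dummy variables placed ABOVE its variables (`g` reads the coordinates `0, …, m-1`) does not
change its circuit complexity over any basis, provided `m ≥ 1`. -/
theorem soloInformed_circuitSizeOver_padHigh_eq (B : Set GateFn) {m : ℕ} (hm : 0 < m) (d : ℕ)
    (g : (Fin m → Bool) → Bool) :
    circuitSizeOver B (fun u : Fin (m + d) → Bool => g (fun i => u (Fin.castAdd d i))) =
      circuitSizeOver B g := by
  refine soloInformed_circuitSizeOver_comp_eq B (Fin.castAdd d)
    (fun k => if h : (k : ℕ) < m then ⟨k, h⟩ else ⟨0, hm⟩) (fun i => ?_) g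
  simp

/-- **Blockwise shape of the low-dummy padding.**  With the dummies as the `d` low-order
variables, bit `p` of the padded truth table is bit `p / 2^d` of `tt g`: every bit of `tt g` is
repeated `2^d` times in a row (so ONE pass over `tt g` drives one pass over the padded table). -/
theorem soloInformed_truthTable_padLow_getElem {m : ℕ} (d : ℕ) (g : (Fin m → Bool) → Bool)
    (p : ℕ) (hp : p < (truthTable fun u : Fin (d + m) → Bool => g fun i => u (Fin.natAdd d i)).length) :
    (truthTable fun u : Fin (d + m) → Bool => g fun i => u (Fin.natAdd d i))[p] =
      (truthTable g)[p / 2 ^ d]'(by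
        rw [length_truthTable] at hp ⊢
        rw [Nat.div_lt_iff_lt_mul (Nat.two_pow_pos d), ← pow_add, Nat.add_comm]; exact hp) := by
  rw [getElem_truthTable, getElem_truthTable]
  congr 1
  funext i
  rw [lowBits_apply, lowBits_apply, Nat.testBit_div_two_pow]
  simp [Nat.add_comm]

/-- **Periodic shape of the high-dummy padding.**  With the dummies as the `d` high-order
variables, bit `p` of the padded truth table is bit `p % 2^m` of `tt g`: the padded table is
`tt g` written out `2^d` times. -/
theorem soloInformed_truthTable_padHigh_getElem {m : ℕ} (d : ℕ) (g : (Fin m → Bool) → Bool)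
    (p : ℕ) (hp : p < (truthTable fun u : Fin (m + d) → Bool => g fun i => u (Fin.castAdd d i)).length) :
    (truthTable fun u : Fin (m + d) → Bool => g fun i => u (Fin.castAdd d i))[p] =
      (truthTable g)[p % 2 ^ m]'(by
        rw [length_truthTable]; exact Nat.mod_lt _ (Nat.two_pow_pos m)) := by
  rw [getElem_truthTable, getElem_truthTable]
  congr 1
  funext i
  rw [lowBits_apply, lowBits_apply, Nat.testBit_mod_two_pow]
  simp [i.2]

/-- **The slices of `MCSP[s]`.**  For every size function `s`, every `m ≥ 1`, every number `d` of
low-order dummy variables and every `g : {0,1}^m → {0,1}`: the blockwise-padded truth table of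
`g` (length `2^(d+m)`) lies in `MCSP[s]` iff `circuitSizeOver B2 g ≤ s (d + m)`.  So `MCSP[s]` at
length `2ⁿ` contains, for every `1 ≤ m ≤ n`, the threshold-`s(n)` circuit-size problem for
`m`-variable functions. -/
theorem soloInformed_truthTable_padLow_mem_MCSPSize_iff (s : ℕ → ℕ) {m : ℕ} (hm : 0 < m) (d : ℕ)
    (g : (Fin m → Bool) → Bool) :
    (truthTable fun u : Fin (d + m) → Bool => g fun i => u (Fin.natAdd d i)) ∈ MCSPSize s ↔
      circuitSizeOver B2 g ≤ s (d + m) := by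
  rw [truthTable_mem_MCSPSize_iff, soloInformed_circuitSizeOver_padLow_eq B2 hm]

/-- The same for high-order dummies (periodic padding). -/
theorem soloInformed_truthTable_padHigh_mem_MCSPSize_iff (s : ℕ → ℕ) {m : ℕ} (hm : 0 < m) (d : ℕ)
    (g : (Fin m → Bool) → Bool) :
    (truthTable fun u : Fin (m + d) → Bool => g fun i => u (Fin.castAdd d i)) ∈ MCSPSize s ↔
      circuitSizeOver B2 g ≤ s (m + d) := by
  rw [truthTable_mem_MCSPSize_iff, soloInformed_circuitSizeOver_padHigh_eq B2 hm]

/-- **The slices of the door's language `MCSP[n]`.**  For `s = id`: the blockwise padding of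
`tt g` to `n = d + m` variables lies in `MCSP[n]` iff `g` has a `B2`-circuit with at most `d + m`
gates.  Reading `d + m = t(m)` for any `t(m) ≥ m` (`t = λm`, `t = m^k`, `t = 2^{m/2}`, …):
`MCSP[n]` decides, on padded inputs, whether an `m`-variable function has circuit complexity at
most `t(m)` — a problem for which no algorithm of running time `2^{o(t log t)}` is known
(exhaustive search; non-uniformly `2^{(4/5+o(1))·t·log₂(t+m)}·poly(2^m)`, Hirahara–Ilango–Williams
2024, Thm 1.3), while a `USTREAM[(log₂ N)^c + c]` decider for `MCSP[n]` would handle it one-pass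
in space `poly(t)` and total time `2^t·poly(t)`. -/
theorem soloInformed_padded_mem_MCSPSize_id_iff {m : ℕ} (hm : 0 < m) (d : ℕ)
    (g : (Fin m → Bool) → Bool) :
    (truthTable fun u : Fin (d + m) → Bool => g fun i => u (Fin.natAdd d i)) ∈
        MCSPSize (fun n => n) ↔ circuitSizeOver B2 g ≤ d + m :=
  soloInformed_truthTable_padLow_mem_MCSPSize_iff (fun n => n) hm d g

end Summit.PneNP.PneNP.Theorems
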